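import Summits.ValiantsHypothesis.ValiantsHypothesis.Theorems.VPBoundarySquareBorderWindowBDS
import Summits.ValiantsHypothesis.ValiantsHypothesis.Theorems.SuccinctLiftSmlAnyFieldDetBDS
import Summits.ValiantsHypothesis.ValiantsHypothesis.Theorems.VPBoundarySquareBorderDepthAlder
import Summits.ValiantsHypothesis.ValiantsHypothesis.Theorems.DecompCycle1CPerBorderConstDepth
import Literature.Computability.AlgebraicComplexity.AndrewsForbes2022Thm68Proofs
import HarnessLib

/-!
# The VP border window on the depth dial: `det` / `per` over ANY field, and the Zariski dial over `ℂ`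

Support file of route `VPBoundarySquare` (lineage `decomp-val-lens-3`, generation 31, stage 2 of the
critic's CALL of OFFER O6).  The border `IMM` window of `VPBoundarySquareBorderWindowLST` /
`VPBoundarySquareBorderWindowBDS` (every field, general circuits, relative depth `σ ≤ 18/25`) is
moved to the determinant and the permanent by PROJECTION (border membership in
`productDepthEdgeClass` is stable under substituting variables / constants and under renaming:
Andrews–Forbes Lemma 6.2), and then read over `ℂ` in the Zariski currency of the route's border square
(`VPBoundarySquareBorderTransfer`, `VPBoundarySquareBorderDepthAlder`: `D̄ = ε-border`).

## Contents (tree currency only: `borderClass`, `productDepthEdgeClass`, `PerInBorderDepthPoly`; no new defs)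

* `mem_borderClass_of_isProjection` — `g ≤_proj f`, `f ∈ D̄(σ, S, Δ)` ⟹ `g ∈ D̄(τ, S, Δ)` over any field
  (one line from V27's `DecompCycle1CPerBorderConstDepth.mem_borderClass_aeval_substVCFun`, imported and
  reused — that module's import of `Theses.DecompCycle1C` is the only Theses module in this file's cone;
  no declaration of it is used).
* `not_detBorderEasy_of_immBorderHard`, `not_perBorderEasy_of_immBorderHard` — lens 2's engine-agnostic
  transports (`SuccinctLiftSmlAnyFieldDetBDS.not_detEasyOver_of_immHard` / `not_perEasyOver_of_immHard`:
  `IMM_{m,⌊√log m⌋}` is a projection of `det_{t(m)}`, `t` p-bounded, over every commutative ring; of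
  `per_{t(m)}` over fields of characteristic `≠ 2` by `VNP`-completeness, `per = det` in characteristic
  `2`; triple-log slack `L₃(m^a + a) ≤ L₃(m) + 1` at tower points) with exact computation replaced by
  BORDER membership throughout — the proofs are verbatim except for the one transport step.
* ★ `not_detBorderEasy_anyField_of_le_18_25`, ★ `not_perBorderEasy_anyField_of_le_18_25` — for EVERY
  field `K`, every `25 p ≤ 18 q` and every `K₀`: `det` (resp. `per`) is NOT in the border of
  p-bounded-wire circuits over `K((ε))` of product depth `⌊p·L₃ n/q⌋ + K₀`.
* ★ `not_perInBorderDepthPoly_of_le_18_25` — over `ℂ`, in the route's Zariski currency: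
  `Ā_Δ = ¬ PerInBorderDepthPoly Δ` for `Δ n = ⌊p·L₃ n/q⌋ + K₀`, `σ = p/q ≤ 18/25`; hence the exact dial
  `A_Δ`, equation certificates at every budget, case (iii) of `dial_trichotomy`, and
  ★ `collapseToBorderDepth_iff_vh_of_le_18_25 : B̄_Δ ↔ VH` on the whole decided window — V28's
  constant-depth reading (`VPBoundarySquareBorderDepthConst`) extended to growing depth `σ ≤ 18/25`.

What this does NOT say: nothing at relative depth `σ ∈ (18/25, 1]` (open in print for border and for
exact computation alike; route `DepthWindow`'s budget), nothing about `VP ≠ VNP`.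

[cite: AndrewsForbes2022, Def. 2.1, Lemma 6.2, Cor. 6.5] [cite: Forbes2024LowDepth, Thm. 1, Cor. 2]
[cite: BhargavDuttaSaxena2024, Thm. 1.4, Rem. 1.5] [cite: Valiant1979] [cite: Burgisser2000, Ch. 2, §4.1]
[cite: BurgisserEtAl2011, §9.3]
-/

-- layout Summits/ValiantsHypothesis/ValiantsHypothesis forces the duplicated namespace component
set_option linter.dupNamespace false

namespace Summit.ValiantsHypothesis.ValiantsHypothesis.Theorems.VPBoundarySquare

open MvPolynomial Literature.Computability.AlgebraicComplexity ArithCircuit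
open Summit.ValiantsHypothesis.ValiantsHypothesis.Theorems.DepthWindow
open Summit.ValiantsHypothesis.ValiantsHypothesis.Theorems.SuccinctLiftSmlAnyField
open Summit.ValiantsHypothesis.ValiantsHypothesis.Theorems.SuccinctLiftSmlAnyFieldBDS
open Summit.ValiantsHypothesis.ValiantsHypothesis.Theorems.SuccinctLiftSmlAnyFieldDet
open Summit.ValiantsHypothesis.ValiantsHypothesis.Theorems.SuccinctLiftTwoNonUnit
open Summit.ValiantsHypothesis.ValiantsHypothesis.Theorems.DefinabilityGapK1DepthLadder

noncomputable section

/-! ### §1 Border membership in `productDepthEdgeClass` is stable under projections (any field) -/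

/-- **Border membership is monotone DOWN projections**: if `g` is a projection of `f` and
`f ∈ D̄(σ, S, Δ)` (the `ε`-border of product-depth-`Δ` circuits with `≤ S` wires over `F((ε))`), then
`g ∈ D̄(τ, S, Δ)`. [cite: AndrewsForbes2022, Lemma 6.2] [cite: Burgisser2000, Def. 2.1] -/
theorem mem_borderClass_of_isProjection {F : Type} [Field F] {σ τ : Type} {g : MvPolynomial τ F}
    {f : MvPolynomial σ F} (h : IsProjection g f) {S Δ : ℕ}
    (hf : f ∈ borderClass F (productDepthEdgeClass (LaurentSeries F) σ S Δ)) :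
    g ∈ borderClass F (productDepthEdgeClass (LaurentSeries F) τ S Δ) := by
  obtain ⟨s, hs⟩ := exists_substVCFun_of_isProjection h
  rw [hs]
  exact DecompCycle1CPerBorderConstDepth.mem_borderClass_aeval_substVCFun s hf

/-! ### §2 From eventual border `IMM` hardness to the `det` / `per` border dials (any field) -/

/-- **From eventual BORDER `IMM` hardness at slope `p/q` over `K` to the DETERMINANT border dial at
slope `p/q` over `K`**: if for every `c`, for all large `m`, `IMM_{m,⌊√log₂ m⌋}` is not in the border of
`≤ m^c + c`-wire circuits of product depth `≤ ⌊p·L₃ m/q⌋ + c` over `K((ε))`, then for no `c` is every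
`det_n` in the border of `≤ n^c + c`-wire circuits of product depth `≤ ⌊p·L₃ n/q⌋ + K₀`.  Lens 2's
transport `not_detEasyOver_of_immHard` with border membership in place of exact computation
(`IMM_{m,⌊√log₂ m⌋}` is a projection of `det_{t m}`, `t` p-bounded; `L₃(m^a + a) ≤ L₃ m + 1` at tower
points). [cite: Valiant1979] [cite: MalodPortier2008] [cite: AndrewsForbes2022, Lemma 6.2] -/
theorem not_detBorderEasy_of_immBorderHard (K : Type) [Field K] {p q : ℕ}
    (hI : ∀ c : ℕ, ∃ m₁ : ℕ, ∀ m : ℕ, m₁ ≤ m →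
      immPoly m (Nat.sqrt (Nat.log 2 m)) K ∉
        borderClass K (productDepthEdgeClass (LaurentSeries K)
          (Fin (Nat.sqrt (Nat.log 2 m)) × Fin m × Fin m) (m ^ c + c)
          (p * Nat.log 2 (Nat.log 2 (Nat.log 2 m)) / q + c)))
    (K₀ : ℕ) :
    ¬ ∃ c : ℕ, ∀ n : ℕ, detPoly (Fin n) K ∈
      borderClass K (productDepthEdgeClass (LaurentSeries K) (Fin n × Fin n) (n ^ c + c)
        (p * Nat.log 2 (Nat.log 2 (Nat.log 2 n)) / q + K₀)) := by
  classical
  rintro ⟨c, hC⟩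
  obtain ⟨t, ⟨a, ha⟩, hproj⟩ :=
    isPProjection_detPoly_of_isVPwsFamily (isVPwsFamily_immPoly_sqrtLog K)
  -- the padded index `t' m = max (t m) m`
  obtain ⟨t', ht'⟩ : ∃ t' : ℕ → ℕ, ∀ m, t' m = max (t m) m := ⟨_, fun _ => rfl⟩
  have ht'le : ∀ m, t' m ≤ m ^ (a + 1) + (a + 1) := fun m => by
    rw [ht']
    refine max_le ((ha m).trans ?_) ?_
    · rcases Nat.eq_zero_or_pos m with rfl | hm
      · rcases Nat.eq_zero_or_pos a with rfl | hapos
        · simp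
        · rw [zero_pow hapos.ne', zero_pow (by omega)]; omega
      · exact Nat.add_le_add (Nat.pow_le_pow_right hm (Nat.le_succ a)) (Nat.le_succ a)
    · calc m = m ^ 1 := (pow_one m).symm
        _ ≤ m ^ (a + 1) := by
            rcases Nat.eq_zero_or_pos m with rfl | hm
            · simp
            · exact Nat.pow_le_pow_right hm (by omega)
        _ ≤ m ^ (a + 1) + (a + 1) := Nat.le_add_right _ _
  obtain ⟨b, hb⟩ : IsPBounded fun m => t' m ^ c + c :=
    IsPBounded.comp_holds (s := fun N => N ^ c + c) ⟨c, fun N => le_rfl⟩ ⟨a + 1, ht'le⟩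
  -- transport: border membership of `det_{t' m}` yields that of `IMM_{m, ⌊√log₂ m⌋}`, same budget, same depth
  have key : ∀ m S Δ : ℕ, detPoly (Fin (t' m)) K ∈
      borderClass K (productDepthEdgeClass (LaurentSeries K) (Fin (t' m) × Fin (t' m)) S Δ) →
      immPoly m (Nat.sqrt (Nat.log 2 m)) K ∈
        borderClass K (productDepthEdgeClass (LaurentSeries K)
          (Fin (Nat.sqrt (Nat.log 2 m)) × Fin m × Fin m) S Δ) := by
    intro m S Δ hmem
    have hproj' : IsProjection (immPoly m (Nat.sqrt (Nat.log 2 m)) K) (detPoly (Fin (t' m)) K) :=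
      IsProjection.trans_holds (hproj m)
        (isProjection_detPoly_of_le K (by rw [ht']; exact le_max_left _ _))
    exact mem_borderClass_of_isProjection hproj' hmem
  -- constants: exponent / depth slack, hardness threshold `m₁`, tower point `m = 2^2^2^Y`
  obtain ⟨m₁, hm₁⟩ := hI (b + p + K₀ + 2)
  obtain ⟨Y, hYa, hYm⟩ : ∃ Y : ℕ, a + 2 ≤ 2 ^ Y ∧ m₁ ≤ Y := by
    refine ⟨a + m₁ + 2, ?_, by omega⟩
    have : a + m₁ + 2 < 2 ^ (a + m₁ + 2) := Nat.lt_two_pow_self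
    omega
  obtain ⟨m, hm⟩ : ∃ m : ℕ, m = 2 ^ (2 ^ (2 ^ Y)) := ⟨_, rfl⟩
  have hYle : Y ≤ m := by
    have h1 : Y < 2 ^ Y := Nat.lt_two_pow_self
    have h2 : 2 ^ Y < 2 ^ (2 ^ Y) := Nat.pow_lt_pow_right (by norm_num) h1
    have h3 : 2 ^ (2 ^ Y) < 2 ^ (2 ^ (2 ^ Y)) := Nat.pow_lt_pow_right (by norm_num) h2
    omega
  have hm1 : 1 ≤ m := hm ▸ Nat.one_le_two_pow
  have hL3m : Nat.log 2 (Nat.log 2 (Nat.log 2 m)) = Y := hm ▸ log3_tower Y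
  have hL3n : Nat.log 2 (Nat.log 2 (Nat.log 2 (t' m))) ≤ Y + 1 :=
    log3_le_of_le_tower_pow Y (a + 1) (t' m) hYa (hm ▸ ht'le m)
  have hdepth : p * Nat.log 2 (Nat.log 2 (Nat.log 2 (t' m))) / q + K₀ ≤
      p * Nat.log 2 (Nat.log 2 (Nat.log 2 m)) / q + (b + p + K₀ + 2) := by
    rw [hL3m]
    have hslack := mul_succ_div_le p Y q
    calc p * Nat.log 2 (Nat.log 2 (Nat.log 2 (t' m))) / q + K₀ ≤ p * (Y + 1) / q + K₀ :=
          Nat.add_le_add_right (Nat.div_le_div_right (Nat.mul_le_mul_left _ hL3n)) _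
      _ ≤ p * Y / q + (b + p + K₀ + 2) := by omega
  have hsize : t' m ^ c + c ≤ m ^ (b + p + K₀ + 2) + (b + p + K₀ + 2) :=
    (hb m).trans (Nat.add_le_add (Nat.pow_le_pow_right hm1 (by omega)) (by omega))
  exact hm₁ m (by omega)
    (borderClass_mono (productDepthEdgeClass_mono₂ _ _ hsize hdepth) (key m _ _ (hC (t' m))))

/-- **From eventual BORDER `IMM` hardness at slope `p/q` over `K` to the PERMANENT border dial at slope
`p/q` over `K`**: characteristic `2` through `per = det`, characteristic `≠ 2` through the
`VNP`-completeness of the permanent over `K` (`isVNPComplete_perPoly_holds`: `IMM` is a p-projection of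
`per`, renamed to `Fin`-indexed variables and back).  Lens 2's `not_perEasyOver_of_immHard` with border
membership in place of exact computation. [cite: Valiant1979] [cite: Burgisser2000, Ch. 2]
[cite: AndrewsForbes2022, Lemma 6.2] -/
theorem not_perBorderEasy_of_immBorderHard (K : Type) [Field K] {p q : ℕ}
    (hI : ∀ c : ℕ, ∃ m₁ : ℕ, ∀ m : ℕ, m₁ ≤ m →
      immPoly m (Nat.sqrt (Nat.log 2 m)) K ∉
        borderClass K (productDepthEdgeClass (LaurentSeries K)
          (Fin (Nat.sqrt (Nat.log 2 m)) × Fin m × Fin m) (m ^ c + c)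
          (p * Nat.log 2 (Nat.log 2 (Nat.log 2 m)) / q + c)))
    (K₀ : ℕ) :
    ¬ ∃ c : ℕ, ∀ n : ℕ, perPoly (Fin n) K ∈
      borderClass K (productDepthEdgeClass (LaurentSeries K) (Fin n × Fin n) (n ^ c + c)
        (p * Nat.log 2 (Nat.log 2 (Nat.log 2 n)) / q + K₀)) := by
  classical
  by_cases hchar : ringChar K = 2
  · haveI : CharP K 2 := ringChar.of_eq hchar
    simp only [perPoly_eq_detPoly_of_charP_two]
    exact not_detBorderEasy_of_immBorderHard K hI K₀
  rintro ⟨c, hC⟩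
  let dd : ℕ → ℕ := fun m => Nat.sqrt (Nat.log 2 m)
  have hdd_le : ∀ m, dd m ≤ m := fun m => (Nat.sqrt_le_self _).trans (Nat.log_le_self 2 m)
  let v : ℕ → ℕ := fun m => Fintype.card (Fin (dd m) × Fin m × Fin m)
  let e : ∀ m, (Fin (dd m) × Fin m × Fin m) ≃ Fin (v m) := fun m => Fintype.equivFin _
  let G : ∀ m, MvPolynomial (Fin (dd m) × Fin m × Fin m) K := fun m => immPoly m (dd m) K
  let G' : ∀ m, MvPolynomial (Fin (v m)) K := fun m => renameEquiv K (e m) (G m)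
  have hv : ∀ m, Fintype.card (Fin (dd m) × Fin m × Fin m) ≤ m ^ 3 + 3 := card_immVars_le
  have hG : IsVPFamily G := by
    refine ⟨⟨⟨3, fun m => hv m⟩, ⟨1, fun m => ?_⟩⟩, ⟨6, fun m => ?_⟩⟩
    · show (immPoly m (dd m) K).totalDegree ≤ m ^ 1 + 1
      refine ((immPoly_isHomogeneous_holds (k := K) m (dd m)).totalDegree_le).trans ?_
      rw [pow_one]; exact (hdd_le m).trans (Nat.le_succ m)
    · show complexity (immPoly m (dd m) K) ≤ m ^ 6 + 6
      calc complexity (immPoly m (dd m) K) ≤ m + 2 * m ^ 3 * dd m := complexity_immPoly_le K m (dd m)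
        _ ≤ m ^ 1 + 2 * (m ^ 1) ^ 3 * m := by
            rw [pow_one]; exact Nat.add_le_add_left (Nat.mul_le_mul_left _ (hdd_le m)) _
        _ ≤ m ^ (3 * 1 + 3) + (3 * 1 + 3) := imm_cost_le 1 m
        _ = m ^ 6 + 6 := by norm_num
  have hG' : IsVPFamily G' := (isVPFamily_renameEquiv_iff e G).2 hG
  have hG'N : IsVNPFamily G' := IsVPFamily.isVNPFamily_holds' hG'
  obtain ⟨t, ht, hproj⟩ := (isVNPComplete_perPoly_holds K hchar).2 v G' hG'N
  obtain ⟨a, ha⟩ := ht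
  obtain ⟨t', ht'⟩ : ∃ t' : ℕ → ℕ, ∀ m, t' m = max (t m) m := ⟨_, fun _ => rfl⟩
  have ht'le : ∀ m, t' m ≤ m ^ (a + 1) + (a + 1) := fun m => by
    rw [ht']
    refine max_le ((ha m).trans ?_) ?_
    · rcases Nat.eq_zero_or_pos m with rfl | hm
      · rcases Nat.eq_zero_or_pos a with rfl | hapos
        · simp
        · rw [zero_pow hapos.ne', zero_pow (by omega)]; omega
      · exact Nat.add_le_add (Nat.pow_le_pow_right hm (Nat.le_succ a)) (Nat.le_succ a)
    · calc m = m ^ 1 := (pow_one m).symm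
        _ ≤ m ^ (a + 1) := by
            rcases Nat.eq_zero_or_pos m with rfl | hm
            · simp
            · exact Nat.pow_le_pow_right hm (by omega)
        _ ≤ m ^ (a + 1) + (a + 1) := Nat.le_add_right _ _
  obtain ⟨b, hb⟩ : IsPBounded fun m => t' m ^ c + c :=
    IsPBounded.comp_holds (s := fun N => N ^ c + c) ⟨c, fun N => le_rfl⟩ ⟨a + 1, ht'le⟩
  -- transport: border membership of `per_{t' m}` yields that of `IMM_{m, dd m}`, same budget, same depth
  have key : ∀ m S Δ : ℕ, perPoly (Fin (t' m)) K ∈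
      borderClass K (productDepthEdgeClass (LaurentSeries K) (Fin (t' m) × Fin (t' m)) S Δ) →
      G m ∈ borderClass K (productDepthEdgeClass (LaurentSeries K) (Fin (dd m) × Fin m × Fin m) S Δ) := by
    intro m S Δ hmem
    have hproj' : IsProjection (G' m) (perPoly (Fin (t' m)) K) :=
      IsProjection.trans_holds (hproj m) (isProjection_perPoly_of_le K (by rw [ht']; exact le_max_left _ _))
    have hG'mem := mem_borderClass_of_isProjection hproj' hmem
    have hGm : MvPolynomial.rename (e m).symm (G' m) = G m := by
      show MvPolynomial.rename (e m).symm (renameEquiv K (e m) (G m)) = G m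
      rw [renameEquiv_apply, rename_rename, (e m).symm_comp_self, rename_id_apply]
    rw [← hGm]
    exact rename_mem_borderClass_productDepthEdgeClass hG'mem (e m).symm
  -- constants: exponent / depth slack, hardness threshold `m₁`, tower point `m = 2^2^2^Y`
  obtain ⟨m₁, hm₁⟩ := hI (b + p + K₀ + 2)
  obtain ⟨Y, hYa, hYm⟩ : ∃ Y : ℕ, a + 2 ≤ 2 ^ Y ∧ m₁ ≤ Y := by
    refine ⟨a + m₁ + 2, ?_, by omega⟩
    have : a + m₁ + 2 < 2 ^ (a + m₁ + 2) := Nat.lt_two_pow_self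
    omega
  obtain ⟨m, hm⟩ : ∃ m : ℕ, m = 2 ^ (2 ^ (2 ^ Y)) := ⟨_, rfl⟩
  have hYle : Y ≤ m := by
    have h1 : Y < 2 ^ Y := Nat.lt_two_pow_self
    have h2 : 2 ^ Y < 2 ^ (2 ^ Y) := Nat.pow_lt_pow_right (by norm_num) h1
    have h3 : 2 ^ (2 ^ Y) < 2 ^ (2 ^ (2 ^ Y)) := Nat.pow_lt_pow_right (by norm_num) h2
    omega
  have hm1 : 1 ≤ m := hm ▸ Nat.one_le_two_pow
  have hL3m : Nat.log 2 (Nat.log 2 (Nat.log 2 m)) = Y := hm ▸ log3_tower Y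
  have hL3n : Nat.log 2 (Nat.log 2 (Nat.log 2 (t' m))) ≤ Y + 1 :=
    log3_le_of_le_tower_pow Y (a + 1) (t' m) hYa (hm ▸ ht'le m)
  have hdepth : p * Nat.log 2 (Nat.log 2 (Nat.log 2 (t' m))) / q + K₀ ≤
      p * Nat.log 2 (Nat.log 2 (Nat.log 2 m)) / q + (b + p + K₀ + 2) := by
    rw [hL3m]
    have hslack := mul_succ_div_le p Y q
    calc p * Nat.log 2 (Nat.log 2 (Nat.log 2 (t' m))) / q + K₀ ≤ p * (Y + 1) / q + K₀ :=
          Nat.add_le_add_right (Nat.div_le_div_right (Nat.mul_le_mul_left _ hL3n)) _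
      _ ≤ p * Y / q + (b + p + K₀ + 2) := by omega
  have hsize : t' m ^ c + c ≤ m ^ (b + p + K₀ + 2) + (b + p + K₀ + 2) :=
    (hb m).trans (Nat.add_le_add (Nat.pow_le_pow_right hm1 (by omega)) (by omega))
  exact hm₁ m (by omega)
    (borderClass_mono (productDepthEdgeClass_mono₂ _ _ hsize hdepth) (key m _ _ (hC (t' m))))

/-! ### §3 ★ The `det` / `per` border dials over EVERY field, every slope `σ ≤ 18/25` -/

/-- ★ **The DETERMINANT is border-hard at product depth `⌊σ·L₃ n⌋ + K₀` over EVERY field, every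
`σ ≤ 18/25`**: for no `c` is every `det_n` in the `ε`-border of `≤ n^c + c`-wire circuits over `K((ε))`
of product depth `≤ ⌊p·L₃ n/q⌋ + K₀` (`25 p ≤ 18 q`).  The border twin of lens 2's
`not_detEasyOver_anyField_of_le_18_25`; slope `σ < 1/2` is the special case also reachable from
stage 1's LST window `immBorderHard_anyField`. [cite: AndrewsForbes2022, Cor. 6.5]
[cite: Forbes2024LowDepth, Cor. 2] [cite: BhargavDuttaSaxena2024, Thm. 1.4, Rem. 1.5] -/
theorem not_detBorderEasy_anyField_of_le_18_25 (K : Type) [Field K] {p q : ℕ} (hpq : 25 * p ≤ 18 * q)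
    (K₀ : ℕ) :
    ¬ ∃ c : ℕ, ∀ n : ℕ, detPoly (Fin n) K ∈
      borderClass K (productDepthEdgeClass (LaurentSeries K) (Fin n × Fin n) (n ^ c + c)
        (p * Nat.log 2 (Nat.log 2 (Nat.log 2 n)) / q + K₀)) :=
  not_detBorderEasy_of_immBorderHard K (fun c => immBorderHard_anyField_bds K hpq c) K₀

/-- ★ **The PERMANENT is border-hard at product depth `⌊σ·L₃ n⌋ + K₀` over EVERY field, every
`σ ≤ 18/25`**. The border twin of lens 2's `not_perEasyOver_anyField_of_le_18_25`.
[cite: AndrewsForbes2022, Cor. 6.5] [cite: Forbes2024LowDepth, Cor. 2]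
[cite: BhargavDuttaSaxena2024, Thm. 1.4, Rem. 1.5] [cite: Valiant1979] -/
theorem not_perBorderEasy_anyField_of_le_18_25 (K : Type) [Field K] {p q : ℕ} (hpq : 25 * p ≤ 18 * q)
    (K₀ : ℕ) :
    ¬ ∃ c : ℕ, ∀ n : ℕ, perPoly (Fin n) K ∈
      borderClass K (productDepthEdgeClass (LaurentSeries K) (Fin n × Fin n) (n ^ c + c)
        (p * Nat.log 2 (Nat.log 2 (Nat.log 2 n)) / q + K₀)) :=
  not_perBorderEasy_of_immBorderHard K (fun c => immBorderHard_anyField_bds K hpq c) K₀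

/-- The endpoint `σ = 18/25` itself over the two-element field's algebraic closure (closed instance: the
border statement has no characteristic hypothesis). [cite: Forbes2024LowDepth, Cor. 2]
[cite: AndrewsForbes2022, Cor. 6.5] -/
theorem not_perBorderEasy_algClosure_two_18_25 (K₀ : ℕ) :
    ¬ ∃ c : ℕ, ∀ n : ℕ, perPoly (Fin n) (AlgebraicClosure (ZMod 2)) ∈
      borderClass (AlgebraicClosure (ZMod 2)) (productDepthEdgeClass
        (LaurentSeries (AlgebraicClosure (ZMod 2))) (Fin n × Fin n) (n ^ c + c)
        (18 * Nat.log 2 (Nat.log 2 (Nat.log 2 n)) / 25 + K₀)) :=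
  not_perBorderEasy_anyField_of_le_18_25 _ (p := 18) (q := 25) le_rfl K₀

/-! ### §4 ★ Over `ℂ`: the route's Zariski dial `Ā_Δ`, decided on the whole window `σ ≤ 18/25` -/

/-- ★ **`Ā_Δ` at growing depth `Δ n = ⌊σ·L₃ n⌋ + K₀`, every `σ ≤ 18/25`**: the permanent family is NOT
in the (Zariski) border of p-bounded-wire product-depth-`Δ` circuits over `ℂ` — the route's dial
`¬ PerInBorderDepthPoly Δ` (`VPBoundarySquareBorderTransfer`), read from the `ε`-border window through
`D̄ = ε-border` (`borderDepthClass_eq_borderClass`, Alder / BIZ18).  V28 decided the constant-depth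
dial (`not_perInBorderDepthPoly_const`); this is the growing-depth window.
[cite: AndrewsForbes2022, Cor. 6.5] [cite: BhargavDuttaSaxena2024, Thm. 1.4] [cite: BurgisserEtAl2011, §9.3] -/
theorem not_perInBorderDepthPoly_of_le_18_25 {p q : ℕ} (hpq : 25 * p ≤ 18 * q) (K₀ : ℕ) :
    ¬ PerInBorderDepthPoly (fun n => p * Nat.log 2 (Nat.log 2 (Nat.log 2 n)) / q + K₀) := by
  rintro ⟨c, hc⟩
  refine not_perBorderEasy_anyField_of_le_18_25 ℂ hpq K₀ ⟨c, fun n => ?_⟩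
  rw [← borderDepthClass_eq_borderClass]
  exact hc n

/-- Hence the exact dial `A_Δ` on the window (lens 2 / lens 4's theorem once more, via `Ā → A`).
[cite: BhargavDuttaSaxena2024, Thm. 1.4] [cite: Forbes2024LowDepth, Thm. 1] -/
theorem not_perInDepthPoly_of_le_18_25 {p q : ℕ} (hpq : 25 * p ≤ 18 * q) (K₀ : ℕ) :
    ¬ PerInDepthPoly (fun n => p * Nat.log 2 (Nat.log 2 (Nat.log 2 n)) / q + K₀) :=
  perHardAtDepth_of_perBorderHardAtDepth (not_perInBorderDepthPoly_of_le_18_25 hpq K₀)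

/-- **Equation certificates against `per` exist on the whole window, at every polynomial budget**
(transfer iff of the record file `VPBoundarySquareBorderTransfer`). [cite: BurgisserEtAl2011, §9.3]
[cite: Grochow2015, §1] -/
theorem per_certificates_of_le_18_25 {p q : ℕ} (hpq : 25 * p ≤ 18 * q) (K₀ c : ℕ) :
    ∃ n : ℕ, ∃ Q : MvPolynomial ((Fin n × Fin n) →₀ ℕ) ℂ,
      (∀ g ∈ DepthClass (Fin n × Fin n) (p * Nat.log 2 (Nat.log 2 (Nat.log 2 n)) / q + K₀) (n ^ c + c),
        aeval (coeffVec g) Q = 0) ∧ aeval (coeffVec (perPoly (Fin n) ℂ)) Q ≠ 0 :=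
  (not_perInBorderDepthPoly_iff_certificates _).1 (not_perInBorderDepthPoly_of_le_18_25 hpq K₀) c

/-- **The dial on the window sits in case (iii) of `dial_trichotomy`**: `A_Δ ∧ Ā_Δ` — `per` is NOT a
boundary family of any product-depth-`⌊σ L₃⌋ + K₀` class, `σ ≤ 18/25`. [folklore] -/
theorem dial_of_le_18_25 {p q : ℕ} (hpq : 25 * p ≤ 18 * q) (K₀ : ℕ) :
    ¬ PerInDepthPoly (fun n => p * Nat.log 2 (Nat.log 2 (Nat.log 2 n)) / q + K₀) ∧
      ¬ PerInBorderDepthPoly (fun n => p * Nat.log 2 (Nat.log 2 (Nat.log 2 n)) / q + K₀) :=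
  ⟨not_perInDepthPoly_of_le_18_25 hpq K₀, not_perInBorderDepthPoly_of_le_18_25 hpq K₀⟩

/-- ★ **On the decided window the border residual is literally the summit**: `B̄_Δ ↔ VH` for
`Δ n = ⌊σ·L₃ n⌋ + K₀`, every `σ ≤ 18/25` (since `Ā_Δ` holds and `B̄ ↔ (Ā → VH)`,
`collapseToBorderDepth_iff_residual`) — V28's constant-depth reading `collapseToBorderDepth_const_iff_vh`
extended to the growing-depth window: below `σ = 18/25` the border square is zero-sum exactly like the
exact one; its open budget is `σ ∈ (18/25, 1]`. [folklore] -/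
theorem collapseToBorderDepth_iff_vh_of_le_18_25 {p q : ℕ} (hpq : 25 * p ≤ 18 * q) (K₀ : ℕ) :
    (VP ℂ = VNP ℂ → PerInBorderDepthPoly (fun n => p * Nat.log 2 (Nat.log 2 (Nat.log 2 n)) / q + K₀)) ↔
      _root_.ValiantsHypothesis := by
  rw [collapseToBorderDepth_iff_residual]
  exact ⟨fun h => h (not_perInBorderDepthPoly_of_le_18_25 hpq K₀), fun h _ => h⟩

/-- The endpoint instance `σ = 18/25`, `K₀ = 0`: `B̄_{⌊18 L₃ n/25⌋} ↔ VH`. [folklore] -/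
theorem collapseToBorderDepth_iff_vh_18_25 :
    (VP ℂ = VNP ℂ → PerInBorderDepthPoly (fun n => 18 * Nat.log 2 (Nat.log 2 (Nat.log 2 n)) / 25)) ↔
      _root_.ValiantsHypothesis := by
  simpa using collapseToBorderDepth_iff_vh_of_le_18_25 (p := 18) (q := 25) le_rfl 0

end

end Summit.ValiantsHypothesis.ValiantsHypothesis.Theorems.VPBoundarySquare
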